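import Literature.Probability.Percolation.AnchoredIsoperimetricProfileProofs
import Literature.Probability.LatticeModels.LatticeBlowUp
import HarnessLib

/-!
# The anchored isoperimetric profile when every edge is open (`p = 1`)

Topic `Literature/Probability/Percolation`. The degenerate endpoint `p = 1` of the NAMED FACT
`CerfDembin2020_thm11` (`AnchoredIsoperimetricProfile.lean`; Cerf–Dembin 2020 Thm. 1.1 = Dembin
2020 Thm. 1: for `p > p_c`, `n φ̂_n(p) → φ(p) > 0` a.s. on `{0 ∈ C_∞}`), PROVED: under `P_1` the
configuration is a.s. the full edge set `E(ℤ^d)`, `C(0) = ℤ^d`, and `φ̂_n` is the deterministic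
lattice isoperimetric profile
`φ̂_n(E) = min { |∂H| / |H| : H ∋ 0 lattice-connected, 0 < |H| ≤ n^d }`. We show

* `tendsto_mul_anchoredProfile_allOpen` — **`n φ̂_n(E) → c_d`**, where
  `c_d = inf_H |∂H| / |H|^{(d-1)/d}` over the competitors (`isoConst`, an `sInf`), and
  `two_le_isoConst` — `c_d ≥ 2 > 0` by the discrete isoperimetric inequality
  `two_mul_rpow_le_card_boundaryPairs` of `DiscreteIsoperimetry.lean` (the sharp value `c_d = 2d`,
  discrete Loomis–Whitney, is not needed);
* `CerfDembin2020_thm11_one` — hence **the conclusion of `CerfDembin2020_thm11` at `p = 1`**: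
  `∃ φ > 0, P_1-a.s., |C(0)| = ∞ → n φ̂_n → φ`, for every `d ≥ 1`.

The limit exists by SCALE INVARIANCE, not by subadditivity: (lower bound) for a competitor `H` with
`|H| ≤ n^d`, `n |∂H|/|H| = (|∂H|/|H|^{(d-1)/d}) · n/|H|^{1/d} ≥ c_d`; (upper bound) the blow-up
`blowUp m H₀` of a near-optimal competitor by blocks of side `k = 2m+1 ≈ n/|H₀|^{1/d}`
(`LatticeBlowUp.lean`: `|blowUp| = k^d |H₀|`, `|∂ blowUp| ≤ k^{d-1} |∂H₀|`, still a competitor)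
has `n |∂|/|·| ≤ (n/(k|H₀|^{1/d})) · |∂H₀|/|H₀|^{(d-1)/d} → |∂H₀|/|H₀|^{(d-1)/d}`. This is a sanity
check of the vendored normalisation (`|H| ≤ n^d`, factor `n`): the rescaled profile has a finite
positive limit at `p = 1`. It says nothing about `p ∈ (p_c, 1)`, where the fact needs Dembin's
proof. Everything is proved; no named fact is introduced.
-/

noncomputable section

namespace Literature.Probability.Percolation

open Finset LatticeModels
open _root_.MeasureTheory _root_.Filter
open scoped _root_.Topology

variable {d : ℕ}

/-! ## The all-open configuration `E(ℤ^d)` -/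

section AllOpen

/-- With every lattice edge open, the open graph is the lattice itself. [folklore] -/
theorem openGraph_edgeSet_zdGraph : openGraph ((zdGraph d).edgeSet) = zdGraph d :=
  SimpleGraph.fromEdgeSet_edgeSet _

/-- All edges open: a valid subgraph is joined to `0` through itself by LATTICE paths.
[cite: CerfDembin2020, §1 (valid subgraph of C(0))] -/
theorem IsValidSubgraph.induce_reachable_of_allOpen {H : Finset (Site d)}
    (h : IsValidSubgraph d (zdGraph d).edgeSet H) {x : Site d} (hx : x ∈ H) :
    ((zdGraph d).induce (↑H : Set (Site d))).Reachable ⟨0, Finset.mem_coe.2 h.1⟩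
      ⟨x, Finset.mem_coe.2 hx⟩ := by
  obtain ⟨h0, hx', hr⟩ := h.2 x hx
  rw [openGraph_edgeSet_zdGraph] at hr
  exact hr

/-- All edges open: a finite `H ∋ 0` joined to `0` through itself by lattice paths is a valid
subgraph. [cite: CerfDembin2020, §1 (valid subgraph of C(0))] -/
theorem isValidSubgraph_allOpen_of_reachable {H : Finset (Site d)} (h0 : (0 : Site d) ∈ H)
    (hH : ∀ x (hx : x ∈ H), ((zdGraph d).induce (↑H : Set (Site d))).Reachable
      ⟨0, Finset.mem_coe.2 h0⟩ ⟨x, Finset.mem_coe.2 hx⟩) :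
    IsValidSubgraph d (zdGraph d).edgeSet H := by
  refine ⟨h0, fun x hx => ⟨Finset.mem_coe.2 h0, Finset.mem_coe.2 hx, ?_⟩⟩
  rw [openGraph_edgeSet_zdGraph]
  exact hH x hx

/-- All edges open: the open edge boundary is the whole lattice edge boundary.
[cite: CerfDembin2020, §1 (∂_𝒢 A)] -/
theorem openEdgeBoundaryCard_allOpen (H : Finset (Site d)) :
    openEdgeBoundaryCard d (zdGraph d).edgeSet H = #(edgeBoundary (zdGraph d) H) := by
  rw [openEdgeBoundaryCard, Set.inter_eq_self_of_subset_left, Set.ncard_coe_finset]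
  intro e he
  exact (mem_edgeBoundary_iff.1 (Finset.mem_coe.1 he)).1

/-- The undirected edge boundary of `LatticeGraph.lean` and the directed one of
`DiscreteIsoperimetry.lean` have the same size: `(x, i, ±) ↦ {x, x ± eᵢ}` is a bijection from
boundary pairs onto boundary edges. [folklore] -/
theorem card_boundaryPairs_eq_card_edgeBoundary (A : Finset (Site d)) :
    #(boundaryPairs A) = #(edgeBoundary (zdGraph d) A) := by
  classical
  refine Finset.card_bij (fun t _ => s(t.1, t.1 + unitStep t.2.1 t.2.2)) ?_ ?_ ?_
  · intro t ht
    rw [mem_boundaryPairs] at ht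
    rw [mem_edgeBoundary_iff]
    exact ⟨(SimpleGraph.mem_edgeSet _).2 (zdGraph_adj_add_unitStep t.1 t.2.1 t.2.2),
      ⟨t.1, ht.1, Sym2.mem_mk_left _ _⟩, ⟨_, ht.2, Sym2.mem_mk_right _ _⟩⟩
  · intro t ht t' ht' h
    rw [mem_boundaryPairs] at ht ht'
    rcases Sym2.eq_iff.1 h with ⟨h1, h2⟩ | ⟨h1, h2⟩
    · rw [h1] at h2
      have hu := single_signedUnit_injective (d := d) (a₁ := (t.2.1, t.2.2)) (a₂ := (t'.2.1, t'.2.2))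
        (add_left_cancel h2)
      simp only [Prod.mk.injEq] at hu
      exact Prod.ext h1 (Prod.ext hu.1 hu.2)
    · exact absurd (h1 ▸ ht.1) ht'.2
  · intro e he
    rw [mem_edgeBoundary_iff] at he
    obtain ⟨heE, ⟨a, ha, hae⟩, ⟨b', hb', hbe⟩⟩ := he
    have hne : a ≠ b' := fun h => hb' (h ▸ ha)
    obtain rfl : e = s(a, b') := (Sym2.mem_and_mem_iff hne).1 ⟨hae, hbe⟩
    have hadj : (zdGraph d).Adj a b' := heE
    obtain ⟨i, hi | hi⟩ := (zdGraph_adj_iff a b').1 hadj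
    · have hb'' : b' = a + unitStep i true := by simpa [unitStep] using hi
      exact ⟨(a, i, true), mem_boundaryPairs.2 ⟨ha, hb'' ▸ hb'⟩, by rw [hb'']⟩
    · have hb'' : b' = a + unitStep i false := by
        funext l
        rw [hi, Pi.add_apply, Pi.add_apply, unitStep_apply]
        by_cases hl : l = i
        · subst hl; simp
        · simp [hl]
      exact ⟨(a, i, false), mem_boundaryPairs.2 ⟨ha, hb'' ▸ hb'⟩, by rw [hb'']⟩

/-- All edges open: `|∂_{C(0)} H| = #(boundaryPairs H)`. [cite: CerfDembin2020, §1 (∂_𝒢 A)] -/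
theorem openEdgeBoundaryCard_allOpen_eq_card_boundaryPairs (H : Finset (Site d)) :
    openEdgeBoundaryCard d (zdGraph d).edgeSet H = #(boundaryPairs H) := by
  rw [openEdgeBoundaryCard_allOpen, card_boundaryPairs_eq_card_edgeBoundary]

/-- All edges open: the blow-up of a valid subgraph is a valid subgraph (`LatticeBlowUp.lean`).
[folklore] -/
theorem IsValidSubgraph.blowUp {H : Finset (Site d)} (hH : IsValidSubgraph d (zdGraph d).edgeSet H)
    (m : ℕ) : IsValidSubgraph d (zdGraph d).edgeSet (blowUp m H) := by
  have hreach := fun x (hx : x ∈ H) => hH.induce_reachable_of_allOpen hx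
  have h0 : (0 : Site d) ∈ LatticeModels.blowUp m H := by
    have := block_subset_blowUp (m := m) hH.1 (center_mem_block m (0 : Site d))
    rwa [smul_zero] at this
  refine isValidSubgraph_allOpen_of_reachable h0 fun z hz => ?_
  obtain ⟨_, hr⟩ := blowUp_induce_reachable_zero hH.1 hreach hz
  exact hr

end AllOpen

/-! ## The scale-invariant ratio `|∂H| / |H|^{(d-1)/d}` and the constant `c_d` -/

section Constant

/-- The lattice isoperimetric constant over the competitors of the anchored profile:
`c_d = inf { #∂H / |H|^{(d-1)/d} : H` a valid subgraph for the all-open configuration `}`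
(an `sInf`; the set is non-empty and bounded below by `2`). [folklore] -/
def isoConst (d : ℕ) : ℝ :=
  sInf {r : ℝ | ∃ H : Finset (Site d), IsValidSubgraph d (zdGraph d).edgeSet H ∧
    r = (#(boundaryPairs H) : ℝ) / (#H : ℝ) ^ (((d : ℝ) - 1) / d)}

/-- The exponents `(d-1)/d` and `1/d` add up to `1` (`d ≥ 1`). [folklore] -/
theorem isoExp_add_inv (hd : 1 ≤ d) : ((d : ℝ) - 1) / d + (d : ℝ)⁻¹ = 1 := by
  have hd' : (d : ℝ) ≠ 0 := by exact_mod_cast (show d ≠ 0 by omega)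
  field_simp
  ring

/-- `N = N^{(d-1)/d} · N^{1/d}` for `N > 0`. [folklore] -/
theorem eq_rpow_isoExp_mul_rpow_inv (hd : 1 ≤ d) {N : ℝ} (hN : 0 < N) :
    N = N ^ (((d : ℝ) - 1) / d) * N ^ ((d : ℝ)⁻¹) := by
  rw [← Real.rpow_add hN, isoExp_add_inv hd, Real.rpow_one]

/-- Every competing ratio is at least `2` (discrete isoperimetric inequality). [folklore] -/
theorem two_le_isoRatio (hd : 1 ≤ d) {H : Finset (Site d)} (hH : H.Nonempty) :
    (2 : ℝ) ≤ (#(boundaryPairs H) : ℝ) / (#H : ℝ) ^ (((d : ℝ) - 1) / d) := by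
  have hpos : (0 : ℝ) < (#H : ℝ) ^ (((d : ℝ) - 1) / d) :=
    Real.rpow_pos_of_pos (by exact_mod_cast hH.card_pos) _
  rw [le_div_iff₀ hpos]
  exact two_mul_rpow_le_card_boundaryPairs d hd H hH

/-- The set defining `isoConst d` is non-empty (`H = {0}`). [folklore] -/
theorem isoConst_set_nonempty (d : ℕ) :
    {r : ℝ | ∃ H : Finset (Site d), IsValidSubgraph d (zdGraph d).edgeSet H ∧
      r = (#(boundaryPairs H) : ℝ) / (#H : ℝ) ^ (((d : ℝ) - 1) / d)}.Nonempty :=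
  ⟨_, {0}, isValidSubgraph_singleton d _, rfl⟩

/-- **`c_d ≥ 2`**, in particular `c_d > 0`. [folklore] -/
theorem two_le_isoConst (hd : 1 ≤ d) : (2 : ℝ) ≤ isoConst d := by
  refine le_csInf (isoConst_set_nonempty d) ?_
  rintro r ⟨H, hH, rfl⟩
  exact two_le_isoRatio hd ⟨0, hH.1⟩

/-- `c_d ≤` every competing ratio. [folklore] -/
theorem isoConst_le (hd : 1 ≤ d) {H : Finset (Site d)} (hH : IsValidSubgraph d (zdGraph d).edgeSet H) :
    isoConst d ≤ (#(boundaryPairs H) : ℝ) / (#H : ℝ) ^ (((d : ℝ) - 1) / d) :=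
  csInf_le ⟨2, by rintro r ⟨H', hH', rfl⟩; exact two_le_isoRatio hd ⟨0, hH'.1⟩⟩ ⟨H, hH, rfl⟩

/-- **Lower bound by scale invariance**: for a competitor `H` with `|H| ≤ n^d`,
`|∂H| / |H|^{(d-1)/d} ≤ n |∂H| / |H|` (since `|H|^{1/d} ≤ n`). [folklore] -/
theorem isoRatio_le_mul_div (hd : 1 ≤ d) {n : ℕ} {H : Finset (Site d)} (hH : H.Nonempty)
    (hle : #H ≤ n ^ d) :
    (#(boundaryPairs H) : ℝ) / (#H : ℝ) ^ (((d : ℝ) - 1) / d) ≤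
      n * ((#(boundaryPairs H) : ℝ) / #H) := by
  have hd0 : d ≠ 0 := by omega
  have hNpos : (0 : ℝ) < #H := by exact_mod_cast hH.card_pos
  have hNe : (0 : ℝ) < (#H : ℝ) ^ (((d : ℝ) - 1) / d) := Real.rpow_pos_of_pos hNpos _
  have hroot : (#H : ℝ) ^ ((d : ℝ)⁻¹) ≤ n := by
    have hle' : (#H : ℝ) ≤ (n : ℝ) ^ d := by exact_mod_cast hle
    calc (#H : ℝ) ^ ((d : ℝ)⁻¹) ≤ ((n : ℝ) ^ d) ^ ((d : ℝ)⁻¹) :=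
          Real.rpow_le_rpow hNpos.le hle' (by positivity)
      _ = n := Real.pow_rpow_inv_natCast (Nat.cast_nonneg n) hd0
  -- `bp / N^{(d-1)/d} = (bp / N) · N^{1/d}` since `N = N^{(d-1)/d} N^{1/d}`
  have hsplit : (#(boundaryPairs H) : ℝ) / (#H : ℝ) ^ (((d : ℝ) - 1) / d) =
      (#(boundaryPairs H) : ℝ) / #H * (#H : ℝ) ^ ((d : ℝ)⁻¹) := by
    rw [div_mul_eq_mul_div, div_eq_div_iff hNe.ne' hNpos.ne', mul_assoc,
      mul_comm ((#H : ℝ) ^ ((d : ℝ)⁻¹)), ← eq_rpow_isoExp_mul_rpow_inv hd hNpos]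
  rw [hsplit, mul_comm (n : ℝ)]
  exact mul_le_mul_of_nonneg_left hroot (by positivity)

/-- **`c_d ≤ n φ̂_n(E)` for every `n ≥ 1`.** [folklore] -/
theorem isoConst_le_mul_anchoredProfile_allOpen (hd : 1 ≤ d) {n : ℕ} (hn : 1 ≤ n) :
    isoConst d ≤ n * anchoredProfile d n (zdGraph d).edgeSet := by
  obtain ⟨H, hH, hpos, hle, heq⟩ := exists_isValidSubgraph_anchoredProfile_eq hn (zdGraph d).edgeSet
  rw [heq, openEdgeBoundaryCard_allOpen_eq_card_boundaryPairs]
  exact (isoConst_le hd hH).trans (isoRatio_le_mul_div hd ⟨0, hH.1⟩ hle)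

end Constant

/-! ## The upper bound: blowing up a near-optimal competitor -/

section Upper

/-- **The blown-up competitor.** For a valid `H₀` (all edges open), `m : ℕ`, `k = 2m+1` and `n`
with `k |H₀|^{1/d} ≤ n`: `blowUp m H₀` is a competitor at level `n` and
`n φ̂_n(E) ≤ (n / (k |H₀|^{1/d})) · |∂H₀| / |H₀|^{(d-1)/d}`. [folklore] -/
theorem mul_anchoredProfile_allOpen_le_of_blowUp (hd : 1 ≤ d) {H₀ : Finset (Site d)}
    (hH₀ : IsValidSubgraph d (zdGraph d).edgeSet H₀) (m n : ℕ)
    (hkn : (2 * m + 1 : ℝ) * (#H₀ : ℝ) ^ ((d : ℝ)⁻¹) ≤ n) :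
    (n : ℝ) * anchoredProfile d n (zdGraph d).edgeSet ≤
      (n : ℝ) / ((2 * m + 1 : ℝ) * (#H₀ : ℝ) ^ ((d : ℝ)⁻¹)) *
        ((#(boundaryPairs H₀) : ℝ) / (#H₀ : ℝ) ^ (((d : ℝ) - 1) / d)) := by
  have hd0 : d ≠ 0 := by omega
  have hNpos : (0 : ℝ) < #H₀ := by exact_mod_cast hH₀.card_pos
  have hkpos : (0 : ℝ) < 2 * m + 1 := by positivity
  -- the blow-up is a competitor at level `n`
  have hB := hH₀.blowUp m
  have hcardB : (#(LatticeModels.blowUp m H₀) : ℝ) = (2 * m + 1 : ℝ) ^ d * #H₀ := by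
    exact_mod_cast card_blowUp m H₀
  have hle : #(LatticeModels.blowUp m H₀) ≤ n ^ d := by
    have h1 : (#(LatticeModels.blowUp m H₀) : ℝ) ≤ (n : ℝ) ^ d := by
      rw [hcardB]
      calc (2 * m + 1 : ℝ) ^ d * #H₀ = ((2 * m + 1 : ℝ) * (#H₀ : ℝ) ^ ((d : ℝ)⁻¹)) ^ d := by
            rw [mul_pow, Real.rpow_inv_natCast_pow hNpos.le hd0]
        _ ≤ (n : ℝ) ^ d := pow_le_pow_left₀ (by positivity) hkn d
    exact_mod_cast h1
  -- its ratio
  have hprof := anchoredProfile_le_div hB hle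
  rw [openEdgeBoundaryCard_allOpen_eq_card_boundaryPairs] at hprof
  have hbp : (#(boundaryPairs (LatticeModels.blowUp m H₀)) : ℝ) ≤
      (2 * m + 1 : ℝ) ^ (d - 1) * #(boundaryPairs H₀) := by
    exact_mod_cast card_boundaryPairs_blowUp_le m H₀
  have hkd : (2 * m + 1 : ℝ) ^ d = (2 * m + 1 : ℝ) ^ (d - 1) * (2 * m + 1) := by
    rw [← pow_succ, Nat.sub_add_cancel hd]
  have hk1 : (2 * m + 1 : ℝ) ^ (d - 1) ≠ 0 := pow_ne_zero _ hkpos.ne'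
  have key : (n : ℝ) / ((2 * m + 1 : ℝ) * (#H₀ : ℝ) ^ ((d : ℝ)⁻¹)) *
      ((#(boundaryPairs H₀) : ℝ) / (#H₀ : ℝ) ^ (((d : ℝ) - 1) / d)) =
      n * #(boundaryPairs H₀) / ((2 * m + 1 : ℝ) * #H₀) := by
    rw [div_mul_div_comm, mul_assoc (2 * m + 1 : ℝ), mul_comm ((#H₀ : ℝ) ^ ((d : ℝ)⁻¹)),
      ← eq_rpow_isoExp_mul_rpow_inv hd hNpos]
  rw [key]
  calc (n : ℝ) * anchoredProfile d n (zdGraph d).edgeSet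
      ≤ n * ((#(boundaryPairs (LatticeModels.blowUp m H₀)) : ℝ) / #(LatticeModels.blowUp m H₀)) :=
        mul_le_mul_of_nonneg_left hprof (Nat.cast_nonneg n)
    _ ≤ n * ((2 * m + 1 : ℝ) ^ (d - 1) * #(boundaryPairs H₀) / ((2 * m + 1 : ℝ) ^ d * #H₀)) := by
        rw [hcardB]
        exact mul_le_mul_of_nonneg_left (div_le_div_of_nonneg_right hbp (by positivity))
          (Nat.cast_nonneg n)
    _ = n * #(boundaryPairs H₀) / ((2 * m + 1 : ℝ) * #H₀) := by
        rw [hkd, mul_assoc ((2 * m + 1 : ℝ) ^ (d - 1)), mul_div_mul_left _ _ hk1, mul_div_assoc]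

/-- **Choice of the scale.** Given `s ≥ 1` (think `s = |H₀|^{1/d}`) and `δ > 0`, for all large `n`
there is an `m` with `k = 2m+1` satisfying `k s ≤ n` and `n ≤ (1 + δ) k s`. [folklore] -/
theorem eventually_exists_blockScale {s δ : ℝ} (hs : 1 ≤ s) (hδ : 0 < δ) :
    ∀ᶠ n : ℕ in atTop, ∃ m : ℕ, (2 * m + 1 : ℝ) * s ≤ n ∧ (n : ℝ) ≤ (1 + δ) * ((2 * m + 1 : ℝ) * s) := by
  have hspos : 0 < s := by linarith
  refine (eventually_ge_atTop ⌈2 * s * (1 + δ) / δ + 2 * s + 1⌉₊).mono fun n hn => ?_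
  have hn' : 2 * s * (1 + δ) / δ + 2 * s + 1 ≤ n := (Nat.le_ceil _).trans (by exact_mod_cast hn)
  have hns : s ≤ n := by
    have : 0 ≤ 2 * s * (1 + δ) / δ := by positivity
    linarith
  -- `m = ⌊(n/s - 1)/2⌋`, so that `n/s - 2 < 2m+1 ≤ n/s`
  set a : ℝ := ((n : ℝ) / s - 1) / 2 with ha
  have ha0 : 0 ≤ a := by
    rw [ha]
    have : 1 ≤ (n : ℝ) / s := by rwa [le_div_iff₀ hspos, one_mul]
    linarith
  refine ⟨⌊a⌋₊, ?_, ?_⟩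
  · have h1 : (⌊a⌋₊ : ℝ) ≤ a := Nat.floor_le ha0
    have h2 : (2 * a + 1) * s = n := by rw [ha]; field_simp; ring
    calc (2 * (⌊a⌋₊ : ℝ) + 1) * s ≤ (2 * a + 1) * s := by gcongr
      _ = n := h2
  · have h1 : a - 1 < ⌊a⌋₊ := Nat.sub_one_lt_floor a
    have h3 : (n : ℝ) - 2 * s < (2 * (⌊a⌋₊ : ℝ) + 1) * s := by
      have : (2 * (a - 1) + 1) * s < (2 * (⌊a⌋₊ : ℝ) + 1) * s := by gcongr
      have h4 : (2 * (a - 1) + 1) * s = n - 2 * s := by rw [ha]; field_simp; ring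
      linarith
    -- `n ≤ (1 + δ)(n - 2s)` from `n ≥ 2 s (1 + δ)/δ`
    have h5 : (n : ℝ) ≤ (1 + δ) * ((n : ℝ) - 2 * s) := by
      have h6 : 2 * s * (1 + δ) / δ ≤ n := by linarith
      rw [div_le_iff₀ hδ] at h6
      nlinarith
    have h7 : (1 + δ) * ((n : ℝ) - 2 * s) ≤ (1 + δ) * ((2 * (⌊a⌋₊ : ℝ) + 1) * s) :=
      mul_le_mul_of_nonneg_left h3.le (by linarith)
    linarith

/-- **Upper bound**: for every competitor `H₀` and `δ > 0`, eventually
`n φ̂_n(E) ≤ (1 + δ) · |∂H₀| / |H₀|^{(d-1)/d}`. [folklore] -/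
theorem eventually_mul_anchoredProfile_allOpen_le (hd : 1 ≤ d) {H₀ : Finset (Site d)}
    (hH₀ : IsValidSubgraph d (zdGraph d).edgeSet H₀) {δ : ℝ} (hδ : 0 < δ) :
    ∀ᶠ n : ℕ in atTop, (n : ℝ) * anchoredProfile d n (zdGraph d).edgeSet ≤
      (1 + δ) * ((#(boundaryPairs H₀) : ℝ) / (#H₀ : ℝ) ^ (((d : ℝ) - 1) / d)) := by
  have hN1 : (1 : ℝ) ≤ #H₀ := by exact_mod_cast hH₀.card_pos
  have hs : (1 : ℝ) ≤ (#H₀ : ℝ) ^ ((d : ℝ)⁻¹) := Real.one_le_rpow hN1 (by positivity)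
  filter_upwards [eventually_exists_blockScale hs hδ] with n hn
  obtain ⟨m, hkn, hnk⟩ := hn
  have hks : 0 < (2 * m + 1 : ℝ) * (#H₀ : ℝ) ^ ((d : ℝ)⁻¹) := by positivity
  have hratio : 0 ≤ (#(boundaryPairs H₀) : ℝ) / (#H₀ : ℝ) ^ (((d : ℝ) - 1) / d) := by positivity
  refine (mul_anchoredProfile_allOpen_le_of_blowUp hd hH₀ m n hkn).trans ?_
  refine mul_le_mul_of_nonneg_right ?_ hratio
  rwa [div_le_iff₀ hks]

end Upper

/-! ## The limit, and Theorem 1.1 at `p = 1` -/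

section Limit

/-- **The rescaled lattice isoperimetric profile converges**: with every edge open,
`n φ̂_n → c_d` (`isoConst d ≥ 2`). [folklore] -/
theorem tendsto_mul_anchoredProfile_allOpen (hd : 1 ≤ d) :
    Tendsto (fun n : ℕ => (n : ℝ) * anchoredProfile d n (zdGraph d).edgeSet) atTop
      (𝓝 (isoConst d)) := by
  have hc : 0 < isoConst d := lt_of_lt_of_le (by norm_num) (two_le_isoConst hd)
  rw [tendsto_order]
  constructor
  · intro a ha
    refine (eventually_ge_atTop 1).mono fun n hn => ?_
    exact ha.trans_le (isoConst_le_mul_anchoredProfile_allOpen hd hn)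
  · intro b hb
    -- a competitor `H₀` with ratio `< (c + b)/2`, then `δ` with `(1 + δ)(c + b)/2 ≤ b`
    have hlt : isoConst d < (isoConst d + b) / 2 := by linarith
    obtain ⟨r, ⟨H₀, hH₀, rfl⟩, hr⟩ := exists_lt_of_csInf_lt (isoConst_set_nonempty d) hlt
    set δ : ℝ := (b - isoConst d) / (isoConst d + b) with hδ
    have hδpos : 0 < δ := by rw [hδ]; exact div_pos (by linarith) (by linarith)
    filter_upwards [eventually_mul_anchoredProfile_allOpen_le hd hH₀ hδpos] with n hn
    refine hn.trans_lt ?_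
    have hr0 : 0 ≤ (#(boundaryPairs H₀) : ℝ) / (#H₀ : ℝ) ^ (((d : ℝ) - 1) / d) := by positivity
    calc (1 + δ) * ((#(boundaryPairs H₀) : ℝ) / (#H₀ : ℝ) ^ (((d : ℝ) - 1) / d))
        < (1 + δ) * ((isoConst d + b) / 2) := mul_lt_mul_of_pos_left hr (by linarith)
      _ = b := by
          rw [hδ]
          have : isoConst d + b ≠ 0 := by linarith
          field_simp
          ring

/-- Under `P_1` the configuration is a.s. the full edge set: `P_1 = δ_{E(ℤ^d)}`. [folklore] -/
theorem bondPercolation_one_eq_dirac :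
    bondPercolation (zdGraph d) 1 = Measure.dirac (zdGraph d).edgeSet := by
  rw [bondPercolation, ProbabilityTheory.setBernoulli_one]

/-- **Cerf–Dembin 2020, Theorem 1.1 at `p = 1` (proved).** For every `d ≥ 1` there is `φ > 0`
(namely `φ = c_d = isoConst d ≥ 2`) such that `P_1`-a.s., if `|C(0)| = ∞` then `n φ̂_n → φ`:
the conclusion of the named fact `CerfDembin2020_thm11` at the endpoint `p = 1`, where a.s. every
edge is open and `φ̂_n` is the deterministic lattice isoperimetric profile. (The content of the
fact is the range `p_c < p < 1`, not addressed here.) [cite: CerfDembin2020, Thm 1.1 (case p = 1)] -/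
theorem CerfDembin2020_thm11_one (hd : 1 ≤ d) :
    ∃ φ : ℝ, 0 < φ ∧ ∀ᵐ ω ∂(bondPercolation (zdGraph d) 1), (openCluster ω 0).Infinite →
      Tendsto (fun n : ℕ => (n : ℝ) * anchoredProfile d n ω) atTop (𝓝 φ) := by
  refine ⟨isoConst d, lt_of_lt_of_le (by norm_num) (two_le_isoConst hd), ?_⟩
  rw [bondPercolation_one_eq_dirac, ae_dirac_eq]
  exact Filter.eventually_pure.2 fun _ => tendsto_mul_anchoredProfile_allOpen hd

end Limit

end Literature.Probability.Percolation

end
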